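import Summits.QuantumFields.YangMills.Theorems.BalabanUVNodesN15TwoSpacingGluingCubes
import HarnessLib

/-!
# THE GLUING STEP AT TWO LATTICE SPACINGS, V: DIRICHLET LOCALIZATION — the cube propagator `G_□ = M_χ(χΔ_aχ + (1 − χ))⁻¹M_χ` as a linear map, the
# per-cube locality `M_{h_□}∘Δ_a∘G_□ = M_{h_□}` of FILE 45 DERIVED (for `h_□` supported in the cube), and the localized letter shapes `1_S(y)1_S(y′)·K` DERIVED
# from supports — so that the gluing chain displays ONLY analytic letters (dag-n15-c g11, FILE 47; N15 = NE2, s1 «background-layer OPERATOR ingredient»)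

Cell `pub-ymgap`, seat `pub-ymgap-dag-n15-c` (R134 (a); HUMAN RULING D-0062), generation 11.  `bears_on: R4∕N15 · K3⁷ SpineGivenEndpointR13SepCoPH (stmt-QuantumFields-20544)`.
Filed `--supports stmt-QuantumFields-20544 --as helper` — COUNT-NEUTRAL.  Two plumbing `def`s (`dirOp`, `cubeInv`), the rest theorems; 0 `sorry`.  Imports BY NAME FILE 45
`…N15TwoSpacingGluingCubes` (`mulOp_comp_mulOp`; through it FILES 43∕44, lit `B11SectG.HasMaj`, `B11AxialTransport190.loc_ofBlocks_le`, `T4EtaRateDefect.idef`, `T4EtaRateCoeffDefect.pull`,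
`B6Prop26Gluing.mulOp`∕`ind`); nothing in the tree is modified.

WHY.  FILES 43–46 glue cube-localized propagators at two spacings and display, besides analytic letters, two STRUCTURAL hypotheses: the per-cube locality `M_{h_□}∘Δ_a∘G_□ = M_{h_□}`
((2.91)'s mechanism) and the localized shape `1_{S_□}(y)1_{S_□}(y′)·K` of the cube letters.  Both are consequences of what a cube propagator IS in [Balaban1984PropagatorsII] §2
(p. 230–231: the operators `Δ_a` restricted to cubes `□̃ ⊃ □` with Dirichlet conditions, their inverses `G_□` extended by zero) — THIS FILE types that: §1 `dirOp Δ χ := M_χΔM_χ +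
M_{1−χ}` (the Dirichlet compression made invertible on the whole lattice), `cubeInv Δ χ := M_χ∘(dirOp Δ χ)⁻¹∘M_χ`; for an idempotent cut-off `χ² = χ`: `cubeInv_supported` (`M_χG_□ = G_□ =
G_□M_χ`), `dirOp_comm_mulOp`, ★★ `compress_comp_cubeInv` (`M_χ∘Δ∘G_□ = M_χ` under `IsUnit [dirOp]`), `cubeInv_comp_compress` (`G_□∘Δ∘M_χ = M_χ`), ★★ **`loc_of_supported`** (`hχ = h` ⟹
`M_h∘Δ∘G_□ = M_h` — FILE 45's `hloc` DISCHARGED), `isUnit_dirOp_of_posDef` (positivity of the compression — [B9] p.395 «the operator Δ_a is positive» — gives the unit); §2 ★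
`hasMaj_localize` (an operator killing inputs away from `S` and producing outputs only over `S` has its majorant localized to `1_S(y)1_S(y′)·K`), `hasMaj_localize_sandwich` (for
`T = M_{χ₂}TM_{χ₁}` with `supp χᵢ` over `S`), ★★ `hasMaj_localize_idef_sandwich` (the same for the η-defect `𝔇(T′, T)` of two such operators through the block pull-back) — FILE 45's
indicator-carrying cube letters DISCHARGED from plain majorants + supports.

HONEST FRAMING ∕ LIMITS.  Finite-dimensional linear algebra ([B6] §2 pp.230–231, (2.91) p.239 = MECHANISM; nothing of [B6]∕[B9] asserted).  After this file the gluing chain's displayed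
inputs are ANALYTIC only: positivity of the cube compressions, the cube inverses' plain (3.42)∕(2.133)-shaped majorants and two-grid defects at both spacings (the lineage's perturbative device
on cubes in the cube's (3.35) gauge — no tree producer), the partition's smoothness ∕ fits ∕ overlap, the `W`-commutator letters.  NE2⁺ NOT PRINTED, NOT proved; N15 NOT discharged; counts of
record UNMOVED (typed 28∕28 · discharged 5∕27); one finite 𝕋⁴ at fixed ε — NOT infinite volume, NOT OS on ℝ⁴, NOT a mass gap, NOT Clay; R4 closes the conditional finite-𝕋⁴ rung
`BalabanLadder.UV` only.  Restate-immune (no Theses import).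
-/

noncomputable section

namespace Summit.QuantumFields.YangMills.BalabanUVNodes.N15.Gluing

open Literature.MathematicalPhysics.QuantumFieldTheory.Balaban1983to89
open Literature.MathematicalPhysics.QuantumFieldTheory.Balaban1983to89.B11SectG (BlockNorm HasMaj)
open Literature.MathematicalPhysics.QuantumFieldTheory.Balaban1983to89.B11AxialTransport190 (loc_ofBlocks_le)
open Literature.MathematicalPhysics.QuantumFieldTheory.Balaban1983to89.T4EtaRateDefect (idef idef_apply)
open Literature.MathematicalPhysics.QuantumFieldTheory.Balaban1983to89.T4EtaRateCoeffDefect (pull pull_apply)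
open Literature.MathematicalPhysics.QuantumFieldTheory.Balaban1983to89.B6Prop26Gluing (mulOp mulOp_apply ind ind_nonneg ind_of_mem ind_of_not_mem)

/-! ## §1 The Dirichlet cube propagator and the per-cube locality -/

section Dirichlet

variable {X : Type} [Fintype X] [DecidableEq X]

/-- THE DIRICHLET COMPRESSION MADE INVERTIBLE ON THE WHOLE LATTICE: `χΔχ + (1 − χ)` (the compression of `Δ` to the functions supported in the cube `{χ = 1}`, the identity on the
complement). [cite: Balaban1984PropagatorsII, pp.230–231 (operators restricted to cubes with Dirichlet conditions: shape)] -/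
def dirOp (Δ : (X → ℝ) →ₗ[ℝ] (X → ℝ)) (χ : X → ℝ) : (X → ℝ) →ₗ[ℝ] (X → ℝ) := mulOp χ ∘ₗ Δ ∘ₗ mulOp χ + mulOp (1 - χ)

/-- **THE CUBE PROPAGATOR** `G_□ = M_χ ∘ (χΔχ + (1 − χ))⁻¹ ∘ M_χ` — the inverse of the Dirichlet compression, extended by zero. [cite: Balaban1984PropagatorsII, pp.230–231 (shape), (2.91) p.239 («G_□»)] -/
def cubeInv (Δ : (X → ℝ) →ₗ[ℝ] (X → ℝ)) (χ : X → ℝ) : (X → ℝ) →ₗ[ℝ] (X → ℝ) :=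
  mulOp χ ∘ₗ Matrix.toLin' (LinearMap.toMatrix' (dirOp Δ χ))⁻¹ ∘ₗ mulOp χ

variable {Δ : (X → ℝ) →ₗ[ℝ] (X → ℝ)} {χ : X → ℝ}

omit [Fintype X] [DecidableEq X] in
/-- An idempotent cut-off is an idempotent multiplication. [folklore] -/
theorem mulOp_idem (hχ : χ * χ = χ) : mulOp χ ∘ₗ mulOp χ = mulOp χ := by rw [mulOp_comp_mulOp, hχ]

omit [Fintype X] [DecidableEq X] in
/-- `M_{1−χ}∘M_χ = 0` for an idempotent cut-off. [folklore] -/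
theorem mulOp_one_sub_comp (hχ : χ * χ = χ) : mulOp (1 - χ) ∘ₗ mulOp χ = 0 := by
  rw [mulOp_comp_mulOp, sub_mul, one_mul, hχ, sub_self]
  exact LinearMap.ext fun f => funext fun x => by simp [mulOp_apply]

omit [Fintype X] [DecidableEq X] in
/-- `M_χ∘M_{1−χ} = 0` for an idempotent cut-off. [folklore] -/
theorem mulOp_comp_one_sub (hχ : χ * χ = χ) : mulOp χ ∘ₗ mulOp (1 - χ) = 0 := by
  rw [mulOp_comp_mulOp, mul_sub, mul_one, hχ, sub_self]
  exact LinearMap.ext fun f => funext fun x => by simp [mulOp_apply]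

/-- The cube propagator is supported in the cube on both sides: `M_χ∘G_□ = G_□ = G_□∘M_χ`. [folklore] -/
theorem cubeInv_supported (hχ : χ * χ = χ) : mulOp χ ∘ₗ cubeInv Δ χ = cubeInv Δ χ ∧ cubeInv Δ χ ∘ₗ mulOp χ = cubeInv Δ χ := by
  refine ⟨?_, ?_⟩
  · rw [cubeInv, ← LinearMap.comp_assoc, mulOp_idem hχ]
  · rw [cubeInv, LinearMap.comp_assoc, LinearMap.comp_assoc, mulOp_idem hχ]

omit [Fintype X] [DecidableEq X] in
/-- The compression commutes with the cut-off: `dirOp∘M_χ = M_χΔM_χ = M_χ∘dirOp`. [folklore] -/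
theorem dirOp_comm_mulOp (hχ : χ * χ = χ) : dirOp Δ χ ∘ₗ mulOp χ = mulOp χ ∘ₗ Δ ∘ₗ mulOp χ ∧ mulOp χ ∘ₗ dirOp Δ χ = mulOp χ ∘ₗ Δ ∘ₗ mulOp χ := by
  refine ⟨?_, ?_⟩
  · rw [dirOp, LinearMap.add_comp, LinearMap.comp_assoc, LinearMap.comp_assoc, mulOp_idem hχ, mulOp_one_sub_comp hχ, add_zero]
  · rw [dirOp, LinearMap.comp_add, ← LinearMap.comp_assoc, mulOp_idem hχ, mulOp_comp_one_sub hχ, add_zero]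

/-- The resolvent of the compression inverts it on both sides under the unit hypothesis. [folklore] -/
theorem dirOp_inverse (hunit : IsUnit (LinearMap.toMatrix' (dirOp Δ χ))) :
    dirOp Δ χ ∘ₗ Matrix.toLin' (LinearMap.toMatrix' (dirOp Δ χ))⁻¹ = LinearMap.id ∧ Matrix.toLin' (LinearMap.toMatrix' (dirOp Δ χ))⁻¹ ∘ₗ dirOp Δ χ = LinearMap.id := by
  have hdet := (Matrix.isUnit_iff_isUnit_det _).1 hunit
  refine ⟨?_, ?_⟩ <;> apply LinearMap.toMatrix'.injective
  · rw [LinearMap.toMatrix'_comp, LinearMap.toMatrix'_toLin', LinearMap.toMatrix'_id, Matrix.mul_nonsing_inv _ hdet]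
  · rw [LinearMap.toMatrix'_comp, LinearMap.toMatrix'_toLin', LinearMap.toMatrix'_id, Matrix.nonsing_inv_mul _ hdet]

/-- The resolvent commutes with the cut-off (because the compression does). [folklore] -/
theorem resolvent_comm_mulOp (hχ : χ * χ = χ) (hunit : IsUnit (LinearMap.toMatrix' (dirOp Δ χ))) :
    Matrix.toLin' (LinearMap.toMatrix' (dirOp Δ χ))⁻¹ ∘ₗ mulOp χ = mulOp χ ∘ₗ Matrix.toLin' (LinearMap.toMatrix' (dirOp Δ χ))⁻¹ := by
  set N := Matrix.toLin' (LinearMap.toMatrix' (dirOp Δ χ))⁻¹ with hN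
  obtain ⟨h1, h2⟩ := dirOp_inverse (Δ := Δ) (χ := χ) hunit
  obtain ⟨hc1, hc2⟩ := dirOp_comm_mulOp (Δ := Δ) hχ
  have hcomm : dirOp Δ χ ∘ₗ mulOp χ = mulOp χ ∘ₗ dirOp Δ χ := by rw [hc1, hc2]
  calc N ∘ₗ mulOp χ = N ∘ₗ mulOp χ ∘ₗ (dirOp Δ χ ∘ₗ N) := by rw [h1, LinearMap.comp_id]
    _ = N ∘ₗ (mulOp χ ∘ₗ dirOp Δ χ) ∘ₗ N := by simp only [LinearMap.comp_assoc]
    _ = N ∘ₗ (dirOp Δ χ ∘ₗ mulOp χ) ∘ₗ N := by rw [hcomm]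
    _ = (N ∘ₗ dirOp Δ χ) ∘ₗ (mulOp χ ∘ₗ N) := by simp only [LinearMap.comp_assoc]
    _ = mulOp χ ∘ₗ N := by rw [h2, LinearMap.id_comp]

/-- ★★ **THE CUBE PROPAGATOR INVERTS `Δ` ON THE CUBE**: `M_χ ∘ Δ ∘ G_□ = M_χ` (idempotent cut-off, the compression a unit). [cite: Balaban1984PropagatorsII, pp.230–231, (2.91) p.239 (mechanism)] -/
theorem compress_comp_cubeInv (hχ : χ * χ = χ) (hunit : IsUnit (LinearMap.toMatrix' (dirOp Δ χ))) : mulOp χ ∘ₗ Δ ∘ₗ cubeInv Δ χ = mulOp χ := by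
  obtain ⟨h1, -⟩ := dirOp_inverse (Δ := Δ) (χ := χ) hunit
  have hNc := resolvent_comm_mulOp (Δ := Δ) hχ hunit
  obtain ⟨N, hN⟩ : ∃ N, Matrix.toLin' (LinearMap.toMatrix' (dirOp Δ χ))⁻¹ = N := ⟨_, rfl⟩
  rw [hN] at h1 hNc
  have hsplit : mulOp χ ∘ₗ Δ ∘ₗ mulOp χ = dirOp Δ χ - mulOp (1 - χ) := by rw [dirOp]; abel
  rw [cubeInv, hN]
  calc mulOp χ ∘ₗ Δ ∘ₗ mulOp χ ∘ₗ N ∘ₗ mulOp χ = (mulOp χ ∘ₗ Δ ∘ₗ mulOp χ) ∘ₗ (N ∘ₗ mulOp χ) := by simp only [LinearMap.comp_assoc]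
    _ = dirOp Δ χ ∘ₗ (N ∘ₗ mulOp χ) - mulOp (1 - χ) ∘ₗ (N ∘ₗ mulOp χ) := by rw [hsplit, LinearMap.sub_comp]
    _ = mulOp χ := by
        rw [← LinearMap.comp_assoc, h1, LinearMap.id_comp, hNc, ← LinearMap.comp_assoc, mulOp_one_sub_comp hχ, LinearMap.zero_comp, sub_zero]

/-- The adjoint-side identity `G_□ ∘ Δ ∘ M_χ = M_χ` (for FILE 44's adjoint arrangement). [cite: Balaban1984PropagatorsII, pp.230–231 (mechanism)] -/
theorem cubeInv_comp_compress (hχ : χ * χ = χ) (hunit : IsUnit (LinearMap.toMatrix' (dirOp Δ χ))) : cubeInv Δ χ ∘ₗ Δ ∘ₗ mulOp χ = mulOp χ := by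
  obtain ⟨-, h2⟩ := dirOp_inverse (Δ := Δ) (χ := χ) hunit
  have hNc := resolvent_comm_mulOp (Δ := Δ) hχ hunit
  obtain ⟨N, hN⟩ : ∃ N, Matrix.toLin' (LinearMap.toMatrix' (dirOp Δ χ))⁻¹ = N := ⟨_, rfl⟩
  rw [hN] at h2 hNc
  have hsplit : mulOp χ ∘ₗ Δ ∘ₗ mulOp χ = dirOp Δ χ - mulOp (1 - χ) := by rw [dirOp]; abel
  rw [cubeInv, hN]
  calc (mulOp χ ∘ₗ N ∘ₗ mulOp χ) ∘ₗ Δ ∘ₗ mulOp χ = (mulOp χ ∘ₗ N) ∘ₗ (mulOp χ ∘ₗ Δ ∘ₗ mulOp χ) := by simp only [LinearMap.comp_assoc]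
    _ = (mulOp χ ∘ₗ N) ∘ₗ dirOp Δ χ - (mulOp χ ∘ₗ N) ∘ₗ mulOp (1 - χ) := by rw [hsplit, LinearMap.comp_sub]
    _ = mulOp χ := by
        rw [LinearMap.comp_assoc, h2, LinearMap.comp_id, ← hNc, LinearMap.comp_assoc, mulOp_comp_one_sub hχ, LinearMap.comp_zero, sub_zero]

omit [Fintype X] [DecidableEq X] in
/-- A function supported in the cube is unchanged by the cut-off: `hχ = h` ⟹ `M_h = M_h∘M_χ`. [folklore] -/
theorem mulOp_eq_comp_of_supported {h : X → ℝ} (hh : h * χ = h) : mulOp h = mulOp h ∘ₗ mulOp χ := by rw [mulOp_comp_mulOp, hh]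

/-- ★★ **FILE 45's PER-CUBE LOCALITY, DISCHARGED**: for a partition function supported in the cube (`h_□χ = h_□`), `M_{h_□} ∘ Δ ∘ G_□ = M_{h_□}`.
[cite: Balaban1984PropagatorsII, (2.91) p.239 (mechanism), (2.36) p.229] -/
theorem loc_of_supported {h : X → ℝ} (hχ : χ * χ = χ) (hunit : IsUnit (LinearMap.toMatrix' (dirOp Δ χ))) (hh : h * χ = h) : mulOp h ∘ₗ Δ ∘ₗ cubeInv Δ χ = mulOp h := by
  rw [mulOp_eq_comp_of_supported hh, LinearMap.comp_assoc, compress_comp_cubeInv hχ hunit]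

/-- POSITIVITY GIVES THE UNIT: if the compression's matrix is positive definite (the Dirichlet problem on the cube for a positive `Δ_a`, [B9] p.395 «the operator Δ_a is positive»),
it is a unit. [cite: Balaban1985BackgroundPropagators, p.395 (positivity of Δ_a)] -/
theorem isUnit_dirOp_of_posDef (hpos : (LinearMap.toMatrix' (dirOp Δ χ)).PosDef) : IsUnit (LinearMap.toMatrix' (dirOp Δ χ)) := hpos.isUnit

end Dirichlet

/-! ## §2 Localized letter shapes from supports -/

section Localize

variable {X₁ X₂ : Type} [Fintype X₁] [Fintype X₂] {g : B6.Geometry} (blk₁ : X₁ → g.Site) (blk₂ : X₂ → g.Site)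

omit [Fintype X₁] in
/-- A function vanishing on the block of `y` has size `0` there. [folklore] -/
theorem loc_ofBlocks_eq_zero {f : X₂ → ℝ} {y : g.Site} (h : ∀ x, blk₂ x = y → f x = 0) : (BlockNorm.ofBlocks g blk₂).loc y f = 0 :=
  le_antisymm (loc_ofBlocks_le blk₂ f le_rfl fun x hx => by rw [h x hx, abs_zero]) ((BlockNorm.ofBlocks g blk₂).loc_nonneg y f)

/-- ★ **LOCALIZATION OF A MAJORANT**: an operator that KILLS every input vanishing over `S` and whose outputs VANISH off `S` has its majorant localized: `K ≥ 0` improves to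
`1_S(y)1_S(y′)·K(y,y′)` (the rectangular twin of lit `B6Prop26Gluing.hasMajorant_localise`). [cite: Balaban1984PropagatorsII, (2.133) p.247 («for y, y′ ∈ 𝔅 ∩ T_□»: shape)] -/
theorem hasMaj_localize {R : (X₁ → ℝ) →ₗ[ℝ] (X₂ → ℝ)} {S : Set g.Site} {K : g.Site → g.Site → ℝ} (hK : ∀ a b, 0 ≤ K a b)
    (hout : ∀ μ x, blk₂ x ∉ S → R μ x = 0) (hin : ∀ μ : X₁ → ℝ, (∀ x, blk₁ x ∈ S → μ x = 0) → R μ = 0)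
    (hR : HasMaj (BlockNorm.ofBlocks g blk₁) (BlockNorm.ofBlocks g blk₂) R K) :
    HasMaj (BlockNorm.ofBlocks g blk₁) (BlockNorm.ofBlocks g blk₂) R (fun y y' => ind S y * ind S y' * K y y') := by
  intro y' μ hμ y
  dsimp only
  have hμ' : ∀ x, blk₁ x ≠ y' → μ x = 0 := hμ
  by_cases hy' : y' ∈ S
  · by_cases hy : y ∈ S
    · rw [ind_of_mem hy, ind_of_mem hy', one_mul, one_mul]
      exact hR y' μ hμ y
    · rw [loc_ofBlocks_eq_zero blk₂ fun x hx => hout μ x (hx ▸ hy)]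
      exact mul_nonneg (mul_nonneg (mul_nonneg (ind_nonneg _ _) (ind_nonneg _ _)) (hK _ _)) ((BlockNorm.ofBlocks g blk₁).loc_nonneg y' μ)
  · have hR0 : R μ = 0 := hin μ fun x hx => hμ' x fun h => hy' (h ▸ hx)
    rw [hR0, (BlockNorm.ofBlocks g blk₂).loc_zero]
    exact mul_nonneg (mul_nonneg (mul_nonneg (ind_nonneg _ _) (ind_nonneg _ _)) (hK _ _)) ((BlockNorm.ofBlocks g blk₁).loc_nonneg y' μ)

omit [Fintype X₁] [Fintype X₂] in
/-- A sandwiched operator `M_{χ₂}∘T∘M_{χ₁}` with `supp χᵢ` over `S` kills inputs vanishing over `S` and produces outputs only over `S`. [folklore] -/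
theorem sandwich_in_out {T : (X₁ → ℝ) →ₗ[ℝ] (X₂ → ℝ)} {χ₁ : X₁ → ℝ} {χ₂ : X₂ → ℝ} {S : Set g.Site} (h1 : ∀ x, χ₁ x ≠ 0 → blk₁ x ∈ S) (h2 : ∀ x, χ₂ x ≠ 0 → blk₂ x ∈ S) :
    (∀ μ x, blk₂ x ∉ S → (mulOp χ₂ ∘ₗ T ∘ₗ mulOp χ₁) μ x = 0) ∧ (∀ μ : X₁ → ℝ, (∀ x, blk₁ x ∈ S → μ x = 0) → (mulOp χ₂ ∘ₗ T ∘ₗ mulOp χ₁) μ = 0) := by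
  refine ⟨fun μ x hx => ?_, fun μ hμ => ?_⟩
  · have hχ : χ₂ x = 0 := by by_contra hne; exact hx (h2 x hne)
    simp only [LinearMap.comp_apply, mulOp_apply, hχ, zero_mul]
  · have h0 : mulOp χ₁ μ = 0 := funext fun x => by
      by_cases hχ : χ₁ x = 0
      · simp [mulOp_apply, hχ]
      · simp [mulOp_apply, hμ x (h1 x hχ)]
    rw [LinearMap.comp_apply, LinearMap.comp_apply, h0, map_zero, map_zero]

/-- **LOCALIZED CUBE LETTERS FROM SUPPORTS**: `T = M_{χ₂}TM_{χ₁}` (e.g. `cubeInv_supported`) with `supp χᵢ` over `S` and a plain majorant `K ≥ 0` ⟹ the localized majorant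
`1_S(y)1_S(y′)·K` of FILE 45's cube letters. [cite: Balaban1984PropagatorsII, (2.133) p.247 (shape)] -/
theorem hasMaj_localize_sandwich {T : (X₁ → ℝ) →ₗ[ℝ] (X₂ → ℝ)} {χ₁ : X₁ → ℝ} {χ₂ : X₂ → ℝ} {S : Set g.Site} {K : g.Site → g.Site → ℝ} (hK : ∀ a b, 0 ≤ K a b)
    (hT : mulOp χ₂ ∘ₗ T ∘ₗ mulOp χ₁ = T) (h1 : ∀ x, χ₁ x ≠ 0 → blk₁ x ∈ S) (h2 : ∀ x, χ₂ x ≠ 0 → blk₂ x ∈ S)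
    (hR : HasMaj (BlockNorm.ofBlocks g blk₁) (BlockNorm.ofBlocks g blk₂) T K) :
    HasMaj (BlockNorm.ofBlocks g blk₁) (BlockNorm.ofBlocks g blk₂) T (fun y y' => ind S y * ind S y' * K y y') := by
  obtain ⟨hout, hin⟩ := sandwich_in_out blk₁ blk₂ (T := T) h1 h2
  rw [hT] at hout hin
  exact hasMaj_localize blk₁ blk₂ hK hout hin hR

end Localize

section LocalizeDefect

variable {X X' : Type} [Fintype X] [Fintype X'] {g : B6.Geometry} (blk : X → g.Site) (π : X' → X)

/-- ★★ **LOCALIZED TWO-GRID DEFECT LETTERS FROM SUPPORTS**: for a coarse cube operator `T = M_χTM_χ` and a fine one `T′ = M_{χ′}T′M_{χ′}` with `supp χ` over `S` (blocks `blk`) and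
`supp χ′` over `S` (blocks `blk ∘ π`), a plain majorant `K ≥ 0` of the η-defect `𝔇(T′, T) = T′∘pull − pull∘T` improves to `1_S(y)1_S(y′)·K` — FILE 45's localized cube DEFECT letters from
plain ones. [cite: Balaban1985BackgroundPropagators, Thm 3.14 pp.426–427 (difference template)] -/
theorem hasMaj_localize_idef_sandwich {T : (X → ℝ) →ₗ[ℝ] (X → ℝ)} {T' : (X' → ℝ) →ₗ[ℝ] (X' → ℝ)} {χ : X → ℝ} {χ' : X' → ℝ} {S : Set g.Site} {K : g.Site → g.Site → ℝ}
    (hK : ∀ a b, 0 ≤ K a b) (hT : mulOp χ ∘ₗ T ∘ₗ mulOp χ = T) (hT' : mulOp χ' ∘ₗ T' ∘ₗ mulOp χ' = T') (h1 : ∀ x, χ x ≠ 0 → blk x ∈ S)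
    (h2 : ∀ x', χ' x' ≠ 0 → blk (π x') ∈ S) (hR : HasMaj (BlockNorm.ofBlocks g blk) (BlockNorm.ofBlocks g (blk ∘ π)) (idef (pull π) (pull π) T' T) K) :
    HasMaj (BlockNorm.ofBlocks g blk) (BlockNorm.ofBlocks g (blk ∘ π)) (idef (pull π) (pull π) T' T) (fun y y' => ind S y * ind S y' * K y y') := by
  obtain ⟨hout, hin⟩ := sandwich_in_out blk blk (T := T) h1 h1
  obtain ⟨hout', hin'⟩ := sandwich_in_out (blk ∘ π) (blk ∘ π) (T := T') h2 h2
  rw [hT] at hout hin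
  rw [hT'] at hout' hin'
  refine hasMaj_localize blk (blk ∘ π) hK (fun μ x' hx' => ?_) (fun μ hμ => ?_) hR
  · rw [idef_apply, Pi.sub_apply, pull_apply, hout' _ x' hx', hout μ (π x') hx', sub_zero]
  · have h0 : T μ = 0 := hin μ hμ
    have h0' : T' (pull π μ) = 0 := hin' _ fun x' hx' => by rw [pull_apply]; exact hμ (π x') hx'
    refine funext fun x' => ?_
    rw [idef_apply, Pi.sub_apply, h0, h0', map_zero, Pi.zero_apply, sub_zero]

end LocalizeDefect

end Summit.QuantumFields.YangMills.BalabanUVNodes.N15.Gluing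

end
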